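import Summits.Ventures.CertifiedManyBodySolver.Downfold.EmeryAxialSlabLa214Windows
import Summits.Ventures.CertifiedManyBodySolver.Downfold.EmeryFermiFillingLSCO
import Summits.Ventures.CertifiedManyBodySolver.Downfold.EmeryFermiFillingLa214
import Summits.Ventures.CertifiedManyBodySolver.Downfold.EmeryAxialConductionBand
import HarnessLib

/-!
# La₂CuO₄ (box #13 La-214 family, x = 0; typed companion emeryBoxLa214v123): the axial co-shift census ON THE TYPED BOX `emeryBoxLa214v123` — verdicts against the object-E row
# `t′/t ∈ [-0.3, -0.2]` and their FOUR-ORBITAL reading (companion of `EmeryAxialSlabLa214Windows`, which carries the method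
# docstring, the slab table and the raw slab windows; the kernel certificates are in `EmeryAxialSlabLa214Subs*`)

Venture CertifiedManyBodySolver, cell `pub/hubbard-downfold` (stage S1), seat hubbard-downfold-mod-4 (technique B); namespace
`Summit.Ventures.CertifiedManyBodySolver.Downfold.Emery`. Everything PROVED. READING (certified): every slab MEETS the E row (no exclusion certified at this resolution).
WHAT THIS IS NOT: not a statement that the material's parameters ARE in the box (SCREENING-GRADE provenance); `U = 0` band kinematics; no phase
sentence; the E row is a [float] literature refit; `a_F` is the ADDITIONAL admixture beyond the box's σ rows (a model-form distance).
Sources: [AndersenEtAl1995, §§5–6]; [PavariniEtAl2001, Eqs. (1)–(3), Fig. 3]; [HybertsenSchluterChristensen1989, Eq. (1)].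
-/

noncomputable section

namespace Summit.Ventures.CertifiedManyBodySolver.Downfold.Emery

open Real Set
open Summit.Ventures.CertifiedManyBodySolver.Downfold

/-! ## §2 The typed box and the co-shift as a parameter -/

/-- The one-body rows and the per-spin filling of `emeryBoxLa214v123` read by this file. [folklore] -/
theorem emeryBoxLa214v123_axRows {p : EmeryCoord → ℝ} (hp : emeryBoxLa214v123.Mem p) :
    p .DeltaPd ∈ Set.Icc (17 / 10 : ℝ) (4 : ℝ) ∧ p .tpd ∈ Set.Icc (129 / 100 : ℝ) (38 / 25 : ℝ) ∧
      p .tpp ∈ Set.Icc (23 / 50 : ℝ) (33 / 50 : ℝ) ∧ p .tppP ∈ Set.Icc (3 / 25 : ℝ) (3 / 20 : ℝ) ∧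
      (2 - p .nHoles) / 2 ∈ Set.Icc (99 / 200 : ℝ) (101 / 200 : ℝ) := by
  obtain ⟨h1, h2, h3, h4, h5, h6, h7, h8, -, -, -, -, -, -, hn1, hn2⟩ := (emeryBoxLa214v123_mem_iff p).1 hp
  push_cast at h1 h2 h3 h4 h5 h6 h7 h8 hn1 hn2
  exact ⟨⟨h1, h2⟩, ⟨h3, h4⟩, ⟨h5, h6⟩, ⟨h7, h8⟩, by constructor <;> linarith⟩

/-- **Slab 0 on the typed box**: for every parameter vector of `emeryBoxLa214v123`, every co-shift `a ∈ [0, 0.05]` and every Fermi energy at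
which the CO-SHIFTED σ antibonding band holds the box's electrons: `ε ∈ [1.06, 2.74]`, `t′/t ∈ [-0.3195, -0.1641]` (MEETS).
[folklore] -/
theorem emeryBoxLa214v123_axSlab0 :
    HoldsOn (fun p : EmeryCoord → ℝ => ∀ a ε : ℝ, a ∈ Set.Icc (0 : ℝ) (1 / 20 : ℝ) →
      abFilling (p .DeltaPd) (p .tpd) (p .tpp + a) (p .tppP + a) ε = (2 - p .nHoles) / 2 →
      ε ∈ Set.Icc (53 / 50 : ℝ) (137 / 50 : ℝ) ∧
      fsRatio (p .DeltaPd) (p .tpd) (p .tpp + a) (p .tppP + a) ε ∈ Set.Icc (-(639 / 2000 : ℝ)) (-(1641 / 10000 : ℝ))) emeryBoxLa214v123 := by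
  intro p hp a ε ha' hf
  obtain ⟨hΔ, ha, hb, hc, hν⟩ := emeryBoxLa214v123_axRows hp
  rw [← hf] at hν
  exact la214AxSlab0_window hΔ ha ⟨by linarith [hb.1, ha'.1], by linarith [hb.2, ha'.2]⟩
    ⟨by linarith [hc.1, ha'.1], by linarith [hc.2, ha'.2]⟩ hν

/-- **Slab 1 on the typed box**: for every parameter vector of `emeryBoxLa214v123`, every co-shift `a ∈ [0.05, 0.1]` and every Fermi energy at
which the CO-SHIFTED σ antibonding band holds the box's electrons: `ε ∈ [1.04, 2.7]`, `t′/t ∈ [-0.345, -0.1881]` (MEETS).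
[folklore] -/
theorem emeryBoxLa214v123_axSlab1 :
    HoldsOn (fun p : EmeryCoord → ℝ => ∀ a ε : ℝ, a ∈ Set.Icc (1 / 20 : ℝ) (1 / 10 : ℝ) →
      abFilling (p .DeltaPd) (p .tpd) (p .tpp + a) (p .tppP + a) ε = (2 - p .nHoles) / 2 →
      ε ∈ Set.Icc (26 / 25 : ℝ) (27 / 10 : ℝ) ∧
      fsRatio (p .DeltaPd) (p .tpd) (p .tpp + a) (p .tppP + a) ε ∈ Set.Icc (-(69 / 200 : ℝ)) (-(1881 / 10000 : ℝ))) emeryBoxLa214v123 := by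
  intro p hp a ε ha' hf
  obtain ⟨hΔ, ha, hb, hc, hν⟩ := emeryBoxLa214v123_axRows hp
  rw [← hf] at hν
  exact la214AxSlab1_window hΔ ha ⟨by linarith [hb.1, ha'.1], by linarith [hb.2, ha'.2]⟩
    ⟨by linarith [hc.1, ha'.1], by linarith [hc.2, ha'.2]⟩ hν

/-- **Slab 2 on the typed box**: for every parameter vector of `emeryBoxLa214v123`, every co-shift `a ∈ [0.1, 0.15]` and every Fermi energy at
which the CO-SHIFTED σ antibonding band holds the box's electrons: `ε ∈ [1.04, 2.68]`, `t′/t ∈ [-0.3691, -0.2104]` (MEETS).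
[folklore] -/
theorem emeryBoxLa214v123_axSlab2 :
    HoldsOn (fun p : EmeryCoord → ℝ => ∀ a ε : ℝ, a ∈ Set.Icc (1 / 10 : ℝ) (3 / 20 : ℝ) →
      abFilling (p .DeltaPd) (p .tpd) (p .tpp + a) (p .tppP + a) ε = (2 - p .nHoles) / 2 →
      ε ∈ Set.Icc (26 / 25 : ℝ) (67 / 25 : ℝ) ∧
      fsRatio (p .DeltaPd) (p .tpd) (p .tpp + a) (p .tppP + a) ε ∈ Set.Icc (-(3691 / 10000 : ℝ)) (-(263 / 1250 : ℝ))) emeryBoxLa214v123 := by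
  intro p hp a ε ha' hf
  obtain ⟨hΔ, ha, hb, hc, hν⟩ := emeryBoxLa214v123_axRows hp
  rw [← hf] at hν
  exact la214AxSlab2_window hΔ ha ⟨by linarith [hb.1, ha'.1], by linarith [hb.2, ha'.2]⟩
    ⟨by linarith [hc.1, ha'.1], by linarith [hc.2, ha'.2]⟩ hν

/-- **Slab 3 on the typed box**: for every parameter vector of `emeryBoxLa214v123`, every co-shift `a ∈ [0.15, 0.2]` and every Fermi energy at
which the CO-SHIFTED σ antibonding band holds the box's electrons: `ε ∈ [1.02, 2.66]`, `t′/t ∈ [-0.3917, -0.229]` (MEETS).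
[folklore] -/
theorem emeryBoxLa214v123_axSlab3 :
    HoldsOn (fun p : EmeryCoord → ℝ => ∀ a ε : ℝ, a ∈ Set.Icc (3 / 20 : ℝ) (1 / 5 : ℝ) →
      abFilling (p .DeltaPd) (p .tpd) (p .tpp + a) (p .tppP + a) ε = (2 - p .nHoles) / 2 →
      ε ∈ Set.Icc (51 / 50 : ℝ) (133 / 50 : ℝ) ∧
      fsRatio (p .DeltaPd) (p .tpd) (p .tpp + a) (p .tppP + a) ε ∈ Set.Icc (-(3917 / 10000 : ℝ)) (-(229 / 1000 : ℝ))) emeryBoxLa214v123 := by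
  intro p hp a ε ha' hf
  obtain ⟨hΔ, ha, hb, hc, hν⟩ := emeryBoxLa214v123_axRows hp
  rw [← hf] at hν
  exact la214AxSlab3_window hΔ ha ⟨by linarith [hb.1, ha'.1], by linarith [hb.2, ha'.2]⟩
    ⟨by linarith [hc.1, ha'.1], by linarith [hc.2, ha'.2]⟩ hν

/-- **Slab 4 on the typed box**: for every parameter vector of `emeryBoxLa214v123`, every co-shift `a ∈ [0.2, 0.25]` and every Fermi energy at
which the CO-SHIFTED σ antibonding band holds the box's electrons: `ε ∈ [1.02, 2.64]`, `t′/t ∈ [-0.4128, -0.2456]` (MEETS).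
[folklore] -/
theorem emeryBoxLa214v123_axSlab4 :
    HoldsOn (fun p : EmeryCoord → ℝ => ∀ a ε : ℝ, a ∈ Set.Icc (1 / 5 : ℝ) (1 / 4 : ℝ) →
      abFilling (p .DeltaPd) (p .tpd) (p .tpp + a) (p .tppP + a) ε = (2 - p .nHoles) / 2 →
      ε ∈ Set.Icc (51 / 50 : ℝ) (66 / 25 : ℝ) ∧
      fsRatio (p .DeltaPd) (p .tpd) (p .tpp + a) (p .tppP + a) ε ∈ Set.Icc (-(258 / 625 : ℝ)) (-(307 / 1250 : ℝ))) emeryBoxLa214v123 := by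
  intro p hp a ε ha' hf
  obtain ⟨hΔ, ha, hb, hc, hν⟩ := emeryBoxLa214v123_axRows hp
  rw [← hf] at hν
  exact la214AxSlab4_window hΔ ha ⟨by linarith [hb.1, ha'.1], by linarith [hb.2, ha'.2]⟩
    ⟨by linarith [hc.1, ha'.1], by linarith [hc.2, ha'.2]⟩ hν

/-- **Slab 5 on the typed box**: for every parameter vector of `emeryBoxLa214v123`, every co-shift `a ∈ [0.25, 0.3]` and every Fermi energy at
which the CO-SHIFTED σ antibonding band holds the box's electrons: `ε ∈ [1.02, 2.62]`, `t′/t ∈ [-0.4324, -0.261]` (MEETS).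
[folklore] -/
theorem emeryBoxLa214v123_axSlab5 :
    HoldsOn (fun p : EmeryCoord → ℝ => ∀ a ε : ℝ, a ∈ Set.Icc (1 / 4 : ℝ) (3 / 10 : ℝ) →
      abFilling (p .DeltaPd) (p .tpd) (p .tpp + a) (p .tppP + a) ε = (2 - p .nHoles) / 2 →
      ε ∈ Set.Icc (51 / 50 : ℝ) (131 / 50 : ℝ) ∧
      fsRatio (p .DeltaPd) (p .tpd) (p .tpp + a) (p .tppP + a) ε ∈ Set.Icc (-(1081 / 2500 : ℝ)) (-(261 / 1000 : ℝ))) emeryBoxLa214v123 := by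
  intro p hp a ε ha' hf
  obtain ⟨hΔ, ha, hb, hc, hν⟩ := emeryBoxLa214v123_axRows hp
  rw [← hf] at hν
  exact la214AxSlab5_window hΔ ha ⟨by linarith [hb.1, ha'.1], by linarith [hb.2, ha'.2]⟩
    ⟨by linarith [hc.1, ha'.1], by linarith [hc.2, ha'.2]⟩ hν

/-- **Slab 6 on the typed box**: for every parameter vector of `emeryBoxLa214v123`, every co-shift `a ∈ [0.3, 0.4]` and every Fermi energy at
which the CO-SHIFTED σ antibonding band holds the box's electrons: `ε ∈ [0.98, 2.64]`, `t′/t ∈ [-0.4718, -0.2748]` (MEETS).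
[folklore] -/
theorem emeryBoxLa214v123_axSlab6 :
    HoldsOn (fun p : EmeryCoord → ℝ => ∀ a ε : ℝ, a ∈ Set.Icc (3 / 10 : ℝ) (2 / 5 : ℝ) →
      abFilling (p .DeltaPd) (p .tpd) (p .tpp + a) (p .tppP + a) ε = (2 - p .nHoles) / 2 →
      ε ∈ Set.Icc (49 / 50 : ℝ) (66 / 25 : ℝ) ∧
      fsRatio (p .DeltaPd) (p .tpd) (p .tpp + a) (p .tppP + a) ε ∈ Set.Icc (-(2359 / 5000 : ℝ)) (-(687 / 2500 : ℝ))) emeryBoxLa214v123 := by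
  intro p hp a ε ha' hf
  obtain ⟨hΔ, ha, hb, hc, hν⟩ := emeryBoxLa214v123_axRows hp
  rw [← hf] at hν
  exact la214AxSlab6_window hΔ ha ⟨by linarith [hb.1, ha'.1], by linarith [hb.2, ha'.2]⟩
    ⟨by linarith [hc.1, ha'.1], by linarith [hc.2, ha'.2]⟩ hν

/-! ## §3 The census verdicts against the E row -/

/-! ## §4 The four-orbital reading (transfer theorem `EmeryAxialConductionBand.condFilling_eq_abFilling`) -/

end Summit.Ventures.CertifiedManyBodySolver.Downfold.Emery
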